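import Summits.QuantumFields.YangMills.Theorems.PoincareLipschitzSphereMapTentOneStep

/-!
# Line «poincare_lipschitz» on crux `HistoryTailL` (stmt-QuantumFields-19936), route crux `BlockLipschitzL` (stmt-QuantumFields-23533), K2 organ of record LOC-REG-MIN —
# FLAT SHADOW «ENERGY → RANGE» (E→R) FOR LATTICE MINIMISERS INTO A SPHERE, FILE 5d-F3c: THE UNMOLLIFIED ONE STEP (regime of ABSOLUTELY small energy, `r²·E_r ≪ 1`) —
# ✓`oneStep_tent` at `r′ = R = r − 1`: the tent radius vanishes identically, `c = u`, the transition band `U = Q_{R−1} ∖ Q_R` is EMPTY, and the only displayed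
# smallness is the ring defect `η ≥ 2d(r−1)√E_r + 2√(d·E_r)`; conclusion `E_ρ ≤ 2A_d((ρ+1)∕(r−2))^d·E_r + 2·sl + 8η·E_r`

Cell `ym3-torus` (YM ladder rung R3 = continuum SU(2) Yang–Mills on the three-torus — a RUNG, NOT the Clay problem: not d = 4, not infinite volume, not a mass gap); width seat
`ym-ust-19936-w5` gen 12 (LEAD ym-ust-19936-w1 g9 2026-08-29T06:49:23Z DISPLAYED `hC` 2e0c4712bb15d94d — this file is regime (b) of my 06:51:10Z answer: it is what makes the
decay constant `A` of `hC` uniform BEFORE `ε`, covering the radii `r ≤ r₀(ε)` where no dyadic band of width `≥ 4` with small relative energy exists).  THEOREMS ONLY (def-free),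
`V` finite-dimensional real inner-product space, any `d ≥ 1`; `--supports stmt-QuantumFields-19936`.  Nothing here proves `hC`, px8's `hone`, E→R, LOC-REG-MIN, `hReg`, `hImprove`,
a stub, `BlockLipschitzL`, `HistoryTailL` or a summit statement.
* §1 `inv_sq_sub_one_le` (`m = 1 − η`, `0 ≤ η ≤ ¼` ⇒ `(m²)⁻¹ − 1 ≤ 4η`), `sum_box_le_sum_box` (monotonicity of the box energy in the radius);
* §2 ★★★ `oneStep_unmollified`.
[folklore] ([SchoenUhlenbeck1982] §4 small-energy improvement, degenerate (unmollified) boundary layer; the lattice statement is this file's).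
-/

set_option autoImplicit false

noncomputable section

open scoped BigOperators InnerProductSpace
open Finset

namespace Summit.QuantumFields.YangMills.Theorems.PoincareLipschitzSphereMapSmallEnergyUnmollified

open Literature.MathematicalPhysics.QuantumFieldTheory.Balaban1983to89
open B4Eq19LatticeOperators
open Summit.QuantumFields.YangMills.Theorems.PoincareLipschitzSphereMapTentOneStep (oneStep_tent)
open Summit.QuantumFields.YangMills.Theorems.PoincareLipschitzSphereMapTentSupport

variable {d : ℕ} {V : Type*} [NormedAddCommGroup V] [InnerProductSpace ℝ V]

/-! ## §1 Two letters -/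

/-- `m = 1 − η` with `0 ≤ η ≤ ¼` ⇒ `(m²)⁻¹ − 1 ≤ 4η` (and `0 < m`, `m ≤ 1`). [folklore] -/
theorem inv_sq_sub_one_le {η : ℝ} (hη0 : 0 ≤ η) (hη4 : η ≤ 1 / 4) :
    ((1 - η) ^ 2)⁻¹ - 1 ≤ 4 * η := by
  have hm : 0 < 1 - η := by linarith
  have hm2 : 0 < (1 - η) ^ 2 := by positivity
  rw [sub_le_iff_le_add, inv_le_iff_one_le_mul₀ hm2]
  nlinarith [mul_nonneg hη0 hη0, mul_nonneg hη0 (mul_nonneg hη0 hη0)]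

omit [InnerProductSpace ℝ V] in
/-- Monotonicity of the box energy in the radius: `ρ ≤ r` ⇒ `E(u;Q_ρ(z)) ≤ E(u;Q_r(z))`. [folklore] -/
theorem sum_box_le_sum_box (u : Zd d → V) (z : Zd d) {ρ r : ℤ} (h : ρ ≤ r) :
    ∑ y ∈ box z ρ, ∑ μ, ‖u (y + unitVec μ) - u y‖ ^ 2 ≤ ∑ y ∈ box z r, ∑ μ, ‖u (y + unitVec μ) - u y‖ ^ 2 :=
  Finset.sum_le_sum_of_subset_of_nonneg (box_subset_box fun i => by rw [sub_self, abs_zero, zero_add]; exact h)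
    fun _ _ _ => Finset.sum_nonneg fun _ _ => by positivity

/-! ## §2 The unmollified one step -/

/-- ★★★ **THE UNMOLLIFIED ONE STEP** (any `d ≥ 1`).  `u : ℤᵈ → V` unit-valued, almost minimising on `Q_r(z)` with constant slack `sl` against unit competitors agreeing with
`u` off `Q_{r−1}(z)`, `r ≥ 2`; `E_r := E(u;Q_r(z))`; `η` a real with `2d(r−1)·√E_r + 2√(d·E_r) ≤ η ≤ ¼` (the near-sphere defect of the harmonic extension of `u∣ring`,
✓F5d-C at mollifier radius `0`).  THEN for every `0 ≤ ρ ≤ r − 3`: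
`E(u;Q_ρ(z)) ≤ 2·A_d·((ρ+1)∕(r−2))^d·E_r + 2·sl + 8η·E_r`, `A_d = 2^d(1+56d)^d(8(d+1))^{d+1}`.
PROOF: ✓`oneStep_tent` at `r′ = R := r − 1` — the tent radius `⌊min(r′ − ‖y−z‖_∞, ‖y−z‖_∞ − r′)₊∕4⌋` is `0` everywhere (✓`tentRadius_eq_zero_of_le`), so `c = u`
(✓`mean_eq_self_of_radius_eq_zero`), `‖c‖ = 1 ≥ ½`, `m := 1 − η ≤ 1 = ‖c‖`; the band `U = Q_{r−2} ∖ Q_{r−1} = ∅`; `(m²)⁻¹ − 1 ≤ 4η` (§1). [folklore]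
[cite: SchoenUhlenbeck1982, §4] -/
theorem oneStep_unmollified [FiniteDimensional ℝ V] (hd : 0 < d) (u : Zd d → V) (z : Zd d) {r : ℤ} (hr : 2 ≤ r)
    (hu : ∀ y, ‖u y‖ = 1)
    {sl : ℝ} (hminU : ∀ w : Zd d → V, (∀ y, ‖w y‖ = 1) → (∀ y ∉ box z (r - 1), w y = u y) →
      ∑ y ∈ box z r, ∑ μ, ‖u (y + unitVec μ) - u y‖ ^ 2 ≤ ∑ y ∈ box z r, ∑ μ, ‖w (y + unitVec μ) - w y‖ ^ 2 + sl)
    {η : ℝ} (hη : 2 * d * (((r - 1 : ℤ) : ℝ)) * Real.sqrt (∑ y ∈ box z r, ∑ μ, ‖u (y + unitVec μ) - u y‖ ^ 2) +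
        2 * Real.sqrt (d * ∑ y ∈ box z r, ∑ μ, ‖u (y + unitVec μ) - u y‖ ^ 2) ≤ η) (hη4 : η ≤ 1 / 4)
    {ρ : ℤ} (hρ : 0 ≤ ρ) (hρr : ρ ≤ r - 3) :
    ∑ y ∈ box z ρ, ∑ μ, ‖u (y + unitVec μ) - u y‖ ^ 2 ≤
      2 * ((2 : ℝ) ^ d * (1 + 56 * d) ^ d * (8 * ((d : ℝ) + 1)) ^ (d + 1) * (((ρ : ℝ) + 1) / ((r : ℝ) - 2)) ^ d) *
          ∑ y ∈ box z r, ∑ μ, ‖u (y + unitVec μ) - u y‖ ^ 2 +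
        2 * sl + 8 * η * ∑ y ∈ box z r, ∑ μ, ‖u (y + unitVec μ) - u y‖ ^ 2 := by
  -- the letters
  set E := ∑ y ∈ box z r, ∑ μ, ‖u (y + unitVec μ) - u y‖ ^ 2 with hE
  have hE0 : 0 ≤ E := Finset.sum_nonneg fun _ _ => Finset.sum_nonneg fun _ _ => by positivity
  have hη0 : 0 ≤ η := by
    have h1 : 0 ≤ 2 * d * (((r - 1 : ℤ) : ℝ)) * Real.sqrt E := by
      have : (0 : ℝ) ≤ ((r - 1 : ℤ) : ℝ) := by exact_mod_cast (by omega : (0 : ℤ) ≤ r - 1)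
      positivity
    have h2 : 0 ≤ 2 * Real.sqrt (d * E) := by positivity
    linarith
  -- the (degenerate) tent mollifier `c = u`
  set c : Zd d → V := fun y => (((box y ((((min (r - 1 - ((Finset.univ.sup fun j => (y j - z j).natAbs : ℕ) : ℤ))
        (((Finset.univ.sup fun j => (y j - z j).natAbs : ℕ) : ℤ) - (2 * (r - 1) - (r - 1)))).toNat / 4 : ℕ) : ℤ))).card : ℝ))⁻¹ •
      ∑ w ∈ box y ((((min (r - 1 - ((Finset.univ.sup fun j => (y j - z j).natAbs : ℕ) : ℤ))
        (((Finset.univ.sup fun j => (y j - z j).natAbs : ℕ) : ℤ) - (2 * (r - 1) - (r - 1)))).toNat / 4 : ℕ) : ℤ)), u w with hcdef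
  have hrad : ∀ y : Zd d, ((((min (r - 1 - ((Finset.univ.sup fun j => (y j - z j).natAbs : ℕ) : ℤ))
        (((Finset.univ.sup fun j => (y j - z j).natAbs : ℕ) : ℤ) - (2 * (r - 1) - (r - 1)))).toNat / 4 : ℕ) : ℤ)) = 0 := by
    intro y
    by_cases h : (((Finset.univ.sup fun j => (y j - z j).natAbs : ℕ) : ℤ)) ≤ (2 * (r - 1) - (r - 1)) + 3
    · exact tentRadius_eq_zero_of_le z (r - 1) (2 * (r - 1) - (r - 1)) y h
    · exact tentRadius_eq_zero_of_ge z (r - 1) (2 * (r - 1) - (r - 1)) y (by push Not at h; omega)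
  have hcu : ∀ y, c y = u y := fun y => mean_eq_self_of_radius_eq_zero u y (hrad y)
  -- the empty band
  have hU : box z (r - 1 - 1) \ box z (2 * (r - 1) - (r - 1)) = ∅ :=
    Finset.sdiff_eq_empty_iff_subset.mpr (box_subset_box fun i => by rw [sub_self, abs_zero, zero_add]; omega)
  have hs0 : ((r - 1 - (r - 1)).toNat / 4 : ℕ) = 0 := by simp
  -- the one step
  have hm : 0 < 1 - η := by linarith
  have h := oneStep_tent hd u c z (r := r) (r' := r - 1) (R := r - 1) hu (fun y => rfl) (by omega) le_rfl (by omega) hminU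
    (fun y _ => by rw [hcu, hu]; norm_num) hm (by linarith)
    (fun y _ _ => by rw [hcu, hu]; linarith)
    (by
      rw [hs0]
      have e1 : (((2 * ((0 : ℕ) : ℤ) + 1 : ℤ) : ℝ)) = 1 := by norm_num
      have e2 : box z (r - 1 + ((0 : ℕ) : ℤ) + 1) = box z r := by congr 1; push_cast; ring
      rw [e1, e2, one_pow, inv_one, one_mul, mul_one, mul_one]
      change 1 - η ≤ 1 - (2 * d * (((r - 1 : ℤ) : ℝ)) * Real.sqrt E + 2 * Real.sqrt (d * E))
      linarith)
    hρ (by omega)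
  rw [hU] at h
  simp only [Finset.sum_empty, mul_zero, add_zero, Real.sqrt_zero] at h
  -- bookkeeping
  have hE' : ∑ y ∈ box z (r - 1), ∑ μ, ‖u (y + unitVec μ) - u y‖ ^ 2 ≤ E := by
    rw [hE]; exact sum_box_le_sum_box u z (by omega)
  have hE'0 : 0 ≤ ∑ y ∈ box z (r - 1), ∑ μ, ‖u (y + unitVec μ) - u y‖ ^ 2 := Finset.sum_nonneg fun _ _ => Finset.sum_nonneg fun _ _ => by positivity
  have hinv : ((1 - η) ^ 2)⁻¹ - 1 ≤ 4 * η := inv_sq_sub_one_le hη0 hη4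
  have hinv0 : 0 ≤ ((1 - η) ^ 2)⁻¹ - 1 := by
    rw [sub_nonneg, one_le_inv₀ (by positivity)]
    nlinarith
  have hden : (((r - 1 - 2 : ℤ) : ℝ) + 1) = (r : ℝ) - 2 := by push_cast; ring
  rw [hden] at h
  have hA0 : 0 ≤ (2 : ℝ) ^ d * (1 + 56 * d) ^ d * (8 * ((d : ℝ) + 1)) ^ (d + 1) * (((ρ : ℝ) + 1) / ((r : ℝ) - 2)) ^ d := by
    have : (0 : ℝ) ≤ (r : ℝ) - 2 := by
      have : (2 : ℝ) ≤ r := by exact_mod_cast hr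
      linarith
    positivity
  have h1 : 2 * ((2 : ℝ) ^ d * (1 + 56 * d) ^ d * (8 * ((d : ℝ) + 1)) ^ (d + 1) * (((ρ : ℝ) + 1) / ((r : ℝ) - 2)) ^ d) *
      ∑ y ∈ box z (r - 1), ∑ μ, ‖u (y + unitVec μ) - u y‖ ^ 2 ≤
      2 * ((2 : ℝ) ^ d * (1 + 56 * d) ^ d * (8 * ((d : ℝ) + 1)) ^ (d + 1) * (((ρ : ℝ) + 1) / ((r : ℝ) - 2)) ^ d) * E :=
    mul_le_mul_of_nonneg_left hE' (by positivity)
  have h2 : (((1 - η) ^ 2)⁻¹ - 1) * ∑ y ∈ box z (r - 1), ∑ μ, ‖u (y + unitVec μ) - u y‖ ^ 2 ≤ 4 * η * E :=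
    mul_le_mul hinv hE' hE'0 (by positivity)
  linarith

end Summit.QuantumFields.YangMills.Theorems.PoincareLipschitzSphereMapSmallEnergyUnmollified
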